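import Literature.AlgebraicGeometry.HodgeTheory.HyperplaneSectionLocalSystem
import Literature.AlgebraicGeometry.HodgeTheory.ComplexGysin
import Literature.AlgebraicTopology.SingularHomology.CupProduct

/-!
# Route LinearSystemTorelli — crux `LocalTubeSpan` (stmt-HodgeConjecture-2490): the Lefschetz splitting

Helper file (`--supports stmt-HodgeConjecture-2490`, line `Sketch` of the crux chain, cycle 5
wave 2, stub `stub_lefschetzSplitting`).

For a family `π : 𝒳 ⟶ Sb` of `n`-dimensional members of a smooth projective `X` of dimension
`m` (`j : 𝒳 ⟶ X`) and a smooth member `X_s`, write `i := ι_s ≫ j : X_s ⟶ X`,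
`i_* : Hⁿ(X_s(ℂ); ℂ) → Hᵇ(X(ℂ); ℂ)` for the Gysin morphism (`complexGysin`, `n + 2m = b + 2n`),
`i^* : Hⁿ(X(ℂ); ℂ) → Hⁿ(X_s(ℂ); ℂ)` for the pull-back (`complexBetti.map`) and
`[X_s] := i_* 1 ∈ Hᶜ(X(ℂ); ℂ)` (`0 + 2m = c + 2n`) for the class of the member.

* `localTubeSpan_complexGysin_map` — `i_* (i^* x) = x ∪ [X_s]` for `x ∈ Hⁿ(X(ℂ); ℂ)`: the
  projection formula `i_*(i^* x ∪ y) = x ∪ i_* y` (`complexGysin_cup`) at `y = 1`, with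
  `i^* x ∪ 1 = i^* x` (`cupProduct_one`).
* `localTubeSpan_lefschetzSplitting` — **the Lefschetz splitting**
  `Hⁿ(X_s(ℂ); ℂ) = Hⁿ(X_s)_van ⊕ i^* Hⁿ(X(ℂ); ℂ)` (as `IsCompl`), where
  `Hⁿ(X_s)_van = ker i_*` (`vanishing`), GRANTED hard Lefschetz for the class of the member in the
  form "`x ↦ x ∪ [X_s]` is bijective `Hⁿ(X) → Hᵇ(X)`" (hypothesis `hHL`; Voisin, *Hodge Theory and
  Complex Algebraic Geometry II*, Prop. 2.27 for hypersurface sections).  Disjointness: if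
  `i^* x ∈ ker i_*` then `x ∪ [X_s] = i_* i^* x = 0`, so `x = 0` by injectivity.  Codisjointness:
  for `y ∈ Hⁿ(X_s)`, surjectivity gives `x` with `x ∪ [X_s] = i_* y`, i.e. `i_* (i^* x) = i_* y`,
  so `y = (y - i^* x) + i^* x ∈ ker i_* + range i^*`.

Where it is used: it discharges the hypothesis `IsCompl (vanishing …) (range i^*)` of the landed
vanishing-carrier assembly `localTubeSpan_vanishingTransfer` /
`LinearSystemTorelliLocalTubeSpanTypedAssemblyVanishing` from hard Lefschetz for the class of the
member.  Pure bookkeeping over the tree's `ComplexGysin` / `HyperplaneSectionLocalSystem` and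
Mathlib; no named facts (`μ.HasPoincareDuality` is a hypothesis).
-/

-- `Summit.HodgeConjecture.HodgeConjecture.Theorems` is the mandated namespace (single-conjunct
-- summit: Sub = Summit), which `linter.dupNamespace` flags on every declaration; the lakefile turns
-- the linter off tree-wide (weak option), restated here so stand-alone elaboration is warning-free.
set_option linter.dupNamespace false

noncomputable section

open CategoryTheory
open Literature.AlgebraicGeometry Literature.AlgebraicGeometry.HodgeTheory
open Literature.AlgebraicTopology.SingularHomology

namespace Summit.HodgeConjecture.HodgeConjecture.Theorems

variable {𝒳 Sb : Motives.SchemeOver ℂ} {π : 𝒳 ⟶ Sb} {n : ℕ}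

/-- **`i_* (i^* x) = x ∪ i_* 1`** for the inclusion `i = ι_s ≫ j : X_s ⟶ X` of a smooth
`n`-dimensional member of the family and `x ∈ Hⁿ(X(ℂ); ℂ)`: the projection formula
`i_*(i^* x ∪ y) = x ∪ i_* y` at `y = 1 ∈ H⁰(X_s(ℂ); ℂ)`, using `i^* x ∪ 1 = i^* x`.
[cite: FultonYoungTableaux1997, Appendix B §B.1 (6)] -/
theorem localTubeSpan_complexGysin_map {X : Motives.SchemeOver ℂ} {j : 𝒳 ⟶ X}
    (μ : OrientationFamily) (hμ : μ.HasPoincareDuality) {m b : ℕ}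
    (hX : Motives.IsSmoothProjective m X) (hb : n + 2 * m = b + 2 * n) (s : smoothFiberLocus π n)
    {c : ℕ} (hc : 0 + 2 * m = c + 2 * n) (hnc : n + c = b) (x : complexBetti X n) :
    complexGysin μ s.2 hX (Motives.fiberι π s.1 ≫ j) hb
        ((complexBetti.map (Motives.fiberι π s.1 ≫ j) n).hom x) =
      cupProduct hnc x (complexGysin μ s.2 hX (Motives.fiberι π s.1 ≫ j) hc
        (singularCohomology.one ℂ (Motives.ComplexPoints (Motives.fiberOver π s.1)))) := by
  have h := complexGysin_cup hμ s.2 hX (Motives.fiberι π s.1 ≫ j) (Nat.add_zero n) hb hc hnc x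
    (singularCohomology.one ℂ (Motives.ComplexPoints (Motives.fiberOver π s.1)))
  rwa [cupProduct_one] at h

/-- **The Lefschetz splitting** `Hⁿ(X_s(ℂ); ℂ) = Hⁿ(X_s)_van ⊕ i^* Hⁿ(X(ℂ); ℂ)` for a smooth
`n`-dimensional member `i = ι_s ≫ j : X_s ⟶ X` of the family, `Hⁿ(X_s)_van = ker i_*`, granted
hard Lefschetz for the class `[X_s] = i_* 1` of the member: if `x ↦ x ∪ [X_s]` is bijective
`Hⁿ(X(ℂ); ℂ) → Hᵇ(X(ℂ); ℂ)`, then `ker i_*` and `range i^*` are complementary subspaces of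
`Hⁿ(X_s(ℂ); ℂ)` (from `i_* i^* x = x ∪ [X_s]`: injectivity gives `ker i_* ⊓ range i^* = 0`,
surjectivity gives `ker i_* + range i^* = Hⁿ(X_s)`). [cite: VoisinHodgeII2003, §2.3.3 Prop. 2.27] -/
theorem localTubeSpan_lefschetzSplitting {X : Motives.SchemeOver ℂ} {j : 𝒳 ⟶ X}
    (μ : OrientationFamily) (hμ : μ.HasPoincareDuality) {m b : ℕ}
    (hX : Motives.IsSmoothProjective m X) (hb : n + 2 * m = b + 2 * n) (s : smoothFiberLocus π n)
    {c : ℕ} (hc : 0 + 2 * m = c + 2 * n) (hnc : n + c = b)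
    (hHL : Function.Bijective fun x : complexBetti X n =>
      cupProduct hnc x (complexGysin μ s.2 hX (Motives.fiberι π s.1 ≫ j) hc
        (singularCohomology.one ℂ (Motives.ComplexPoints (Motives.fiberOver π s.1))))) :
    IsCompl (vanishing π n j μ hX hb s)
      (LinearMap.range (complexBetti.map (Motives.fiberι π s.1 ≫ j) n).hom) := by
  -- `G = i_*`, `R = i^*`, `cls = [X_s] = i_* 1`; key identity `G (R x) = x ∪ cls`
  set G := complexGysin μ s.2 hX (Motives.fiberι π s.1 ≫ j) hb with hG
  set R := (complexBetti.map (Motives.fiberι π s.1 ≫ j) n).hom with hR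
  have key : ∀ x : complexBetti X n, G (R x) =
      cupProduct hnc x (complexGysin μ s.2 hX (Motives.fiberι π s.1 ≫ j) hc
        (singularCohomology.one ℂ (Motives.ComplexPoints (Motives.fiberOver π s.1)))) :=
    fun x => localTubeSpan_complexGysin_map μ hμ hX hb s hc hnc x
  have hzero : cupProduct hnc (0 : complexBetti X n)
      (complexGysin μ s.2 hX (Motives.fiberι π s.1 ≫ j) hc
        (singularCohomology.one ℂ (Motives.ComplexPoints (Motives.fiberOver π s.1)))) = 0 := by
    rw [← key 0, map_zero, map_zero]
  refine ⟨?_, ?_⟩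
  · -- disjoint: `R x ∈ ker G` forces `x ∪ cls = 0`, hence `x = 0`
    rw [Submodule.disjoint_def]
    rintro y hy ⟨x, rfl⟩
    have hx : x = 0 := by
      apply hHL.1
      change cupProduct hnc x _ = cupProduct hnc 0 _
      rw [hzero, ← key x]
      exact (mem_vanishing_iff π n j μ hX hb s (R x)).1 hy
    rw [hx, map_zero]
  · -- codisjoint: `G y = x ∪ cls = G (R x)` for some `x`, so `y - R x ∈ ker G`
    rw [codisjoint_iff, eq_top_iff]
    rintro y -
    obtain ⟨x, hx⟩ := hHL.2 (G y)
    have hmem : y - R x ∈ vanishing π n j μ hX hb s := by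
      rw [mem_vanishing_iff, map_sub, sub_eq_zero]
      change G y = G (R x)
      rw [key x]
      exact hx.symm
    have hsum : y = (y - R x) + R x := (sub_add_cancel y (R x)).symm
    rw [hsum]
    exact Submodule.add_mem_sup hmem (LinearMap.mem_range_self R x)

end Summit.HodgeConjecture.HodgeConjecture.Theorems

end
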